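import Mathlib
import Literature.Combinatorics.Optimization.FourierTailRandomSubset
import Literature.Combinatorics.Optimization.PseudoDensityFourier
import Literature.Combinatorics.Optimization.MaxThreeSatLpLowerBound
import HarnessLib

/-!
# Chan–Lee–Raghavendra–Steurer §3.2–3.3: the random restriction (Lemma 3.5, combinatorial core),
# averaged restrictions of densities, junta averaging, and the truncated Sherali–Adams functional
# (Lemma 2.4) — PROVED

Second brick of the proof of [ChanEtAl2016, Thm 3.1/3.2] (`ChanEtAl2016_thm31/_thm32`, typed in
`LpRelaxationsVersusSheraliAdams.lean`).  Source: arXiv:1309.0563v3, §2.1 Lemma 2.4 (p. 8), §3.2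
Lemma 3.5 (p. 9–10), §3.3 (p. 10).  Everything here is PROVED (finite sums and counting); 0 named
facts.  Contents:

* **Lemma 3.5, combinatorial core** (`exists_subset_small_meet`): given at most `2 n^{d/2}` sets
  `J'_i ⊆ [n]` each of size `≤ √n/(8m)` (the junta sets of Lemma 3.3 for densities of entropy
  `≥ n − t`, `γ = (16 m t d/√n)^{1/2}`), `1 ≤ d ≤ m`, `4m ≤ n`, there is an `m`-subset `S ⊆ [n]` with
  `|J'_i ∩ S| < d` for every `i`.  DEVIATION from the printed proof (recorded): the paper samples
  `S` by including each element independently with probability `2m/n` and uses a Chernoff bound for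
  `|S| ≥ m`; we draw `S` UNIFORMLY among the `m`-subsets and use the tree's hypergeometric count
  `card_filter_le_card_inter_le_pow` (`#{S : |S| = m, |J' ∩ S| ≥ d} ≤ (|J'| m/(n−m))^d C(n,m)`, proved
  for LRS Lemma 3.7) — same union bound `≤ 2·6^{−d} C(n,m) < C(n,m)`, no Chernoff step.
* **Averaged restriction** (`avgRestrict e q`, §3.3 p. 10: "`q^S_i = Σ_{α ⊆ S} q̂_i(α) χ_α` … the
  conditional density on the variables in `S` (equivalently, we obtain `q^S_i` by averaging over all
  variables outside `S`)"): along an embedding `e : [m] ↪ [n]`, `(avgRestrict e q)(y)` is the average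
  of `q` over the `2^{n−m}` points `x` with `x ∘ e = y` (`cubeSplit e : {0,1}^n ≃ {0,1}^m × {0,1}^{[n]∖e[m]}`);
  it is a density if `q` is (`sum_avgRestrict`), inherits `0 ≤ q ≤ K`, has Fourier coefficients
  `(avgRestrict e q)^(α) = q̂(e(α))` (`cubeFourierCoeff_avgRestrict`), and averaging a pointwise
  identity `F(x ∘ e) = Σ_l a_l V_l(x)` gives `F = Σ_l a_l · avgRestrict e V_l`
  (`eq_sum_avgRestrict_of_forall`) — the passage from eq. (3.2) to its restriction to `S`.
* **Junta averaging** (`avgOutside J f`, p. 10: "`q̃^S_i = Σ_{α ⊆ J(q_i) ∩ S} q̂_i(α) χ_α` is a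
  non-negative `d`-junta"): the average of `f` over the coordinates outside `J` is a nonnegative
  `|J|`-junta with coefficients `f̂(α)·[α ⊆ J]`.
* **Lemma 2.4 and the truncated functional** (§2.1 p. 8: a `d`-ℓ.e.f. extended "by setting
  `Ẽ f = 0` for all functions `f` orthogonal to … `{χ_α : |α| ≤ d}`"): the tree's
  `SAPseudoexpectation m d` acts on ALL functions; `SAPseudoexpectation.truncate` precomposes it with
  the projection `fourierTruncate d` and is again a degree-`d` pseudoexpectation agreeing with the
  original on functions of degree `≤ d` (`truncate_E_of_hasDegreeLE`), with `|Ẽ χ_α| ≤ 1` for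
  `|α| ≤ d` (`abs_E_walsh_le_one`, Lemma 2.4(ii)) and hence
  `|Ẽ_trunc f| ≤ Σ_{|α| ≤ d} |f̂(α)|` (`abs_truncate_E_le`, the form of Lemma 2.4(iii) used on p. 10).
-/

noncomputable section

open Finset
open Literature.Probability.RandomGraphs.LowDegree (walsh sgn)
open Literature.Computability.Complexity.LowDegree (cubeFourierCoeff sum_cubeFourierCoeff_mul_walsh
  cubeFourierCoeff_piecewise)

namespace Literature.Combinatorics.Optimization

/-! ### Lemma 3.5, combinatorial core: an `m`-subset meeting every junta set in fewer than `d` points -/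

/-- **CLRS Lemma 3.5 (combinatorial core, uniform `m`-subsets).**  Let `1 ≤ d ≤ m`, `4m ≤ n`, and let
`J'_i ⊆ [n]` (`i < R`, `R ≤ 2·(√n)^d`) have `|J'_i| ≤ √n/(8m)`.  Then some `m`-subset `S ⊆ [n]`
satisfies `|J'_i ∩ S| < d` for all `i` (union bound: each bad event has at most
`(|J'_i| m/(n−m))^d C(n,m) ≤ (6√n)^{−d} C(n,m)` subsets).
[cite: ChanEtAl2016, Lemma 3.5 (arXiv v3 p. 9–10, proof: "P[|J(q) ∩ S| ≥ d] ≤ 2 (2m/n · |J'(q)|)^d ≤ 2/(4^d n^{d/2})" and the union bound over |Q| ≤ n^{d/2})] -/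
theorem exists_subset_small_meet {n m d R : ℕ} (hd : 1 ≤ d) (hdm : d ≤ m) (h4m : 4 * m ≤ n)
    (J : Fin R → Finset (Fin n)) (hJ : ∀ i, ((J i).card : ℝ) ≤ Real.sqrt n / (8 * m))
    (hR : (R : ℝ) ≤ 2 * Real.sqrt n ^ d) :
    ∃ S : Finset (Fin n), S.card = m ∧ ∀ i, (J i ∩ S).card < d := by
  classical
  have hm1 : 1 ≤ m := hd.trans hdm
  have hmn : m < n := by omega
  have hn0 : (0 : ℝ) < n := by exact_mod_cast (show 0 < n by omega)
  have hm0 : (0 : ℝ) < m := by exact_mod_cast (show 0 < m by omega)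
  have hsq0 : 0 < Real.sqrt n := Real.sqrt_pos.2 hn0
  have hnm : (0 : ℝ) < (n : ℝ) - m := by
    have : (m : ℝ) < n := by exact_mod_cast hmn
    linarith
  -- the bad `m`-subsets for index `i`
  set bad : Fin R → Finset (Finset (Fin n)) := fun i =>
    (univ.powersetCard m).filter fun S : Finset (Fin n) => d ≤ (J i ∩ S).card with hbad
  have hbad_le : ∀ i, ((bad i).card : ℝ) ≤ (1 / (6 * Real.sqrt n)) ^ d * n.choose m := by
    intro i
    have h := card_filter_le_card_inter_le_pow m d hdm hmn (J i)
    refine h.trans (mul_le_mul_of_nonneg_right ?_ (Nat.cast_nonneg _))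
    refine pow_le_pow_left₀ (by positivity) ?_ d
    -- `|J'| m/(n−m) ≤ (√n/(8m))·m/(n−m) = √n/(8(n−m)) ≤ 1/(6√n)`
    have h8 : 6 * (n : ℝ) ≤ 8 * ((n : ℝ) - m) := by
      have : (4 : ℝ) * m ≤ n := by exact_mod_cast h4m
      linarith
    rw [div_le_div_iff₀ hnm (by positivity)]
    calc ((J i).card : ℝ) * m * (6 * Real.sqrt n) ≤ Real.sqrt n / (8 * m) * m * (6 * Real.sqrt n) := by
          gcongr; exact hJ i
      _ = 6 * (Real.sqrt n * Real.sqrt n) / 8 := by field_simp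
      _ = 6 * n / 8 := by rw [Real.mul_self_sqrt hn0.le]
      _ ≤ 1 * ((n : ℝ) - m) := by linarith
  -- union bound
  have hunion : (((univ : Finset (Fin R)).biUnion bad).card : ℝ) < ((univ.powersetCard m :
      Finset (Finset (Fin n))).card : ℝ) := by
    have hC : (0 : ℝ) < n.choose m := by exact_mod_cast Nat.choose_pos hmn.le
    calc (((univ : Finset (Fin R)).biUnion bad).card : ℝ)
        ≤ ∑ i, ((bad i).card : ℝ) := by exact_mod_cast card_biUnion_le
      _ ≤ ∑ _i : Fin R, (1 / (6 * Real.sqrt n)) ^ d * (n.choose m : ℝ) := sum_le_sum fun i _ => hbad_le i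
      _ = R * ((1 / (6 * Real.sqrt n)) ^ d * n.choose m) := by
          rw [sum_const, card_univ, Fintype.card_fin, nsmul_eq_mul]
      _ ≤ 2 * Real.sqrt n ^ d * ((1 / (6 * Real.sqrt n)) ^ d * n.choose m) := by gcongr
      _ = 2 * (Real.sqrt n * (1 / (6 * Real.sqrt n))) ^ d * n.choose m := by rw [mul_pow]; ring
      _ = 2 * (1 / 6) ^ d * n.choose m := by
          have hx : Real.sqrt n * (1 / (6 * Real.sqrt n)) = 1 / 6 := by field_simp
          rw [hx]
      _ ≤ 2 * (1 / 6) ^ 1 * n.choose m := by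
          have h := pow_le_pow_of_le_one (by norm_num : (0:ℝ) ≤ 1 / 6) (by norm_num) hd
          exact mul_le_mul_of_nonneg_right (mul_le_mul_of_nonneg_left h zero_le_two) hC.le
      _ < n.choose m := by linarith
      _ = ((univ.powersetCard m : Finset (Finset (Fin n))).card : ℝ) := by
          rw [card_powersetCard, card_univ, Fintype.card_fin]
  have hlt : ((univ : Finset (Fin R)).biUnion bad).card <
      (univ.powersetCard m : Finset (Finset (Fin n))).card := by exact_mod_cast hunion
  -- a good subset exists
  obtain ⟨S, hS, hSbad⟩ : ∃ S ∈ (univ.powersetCard m : Finset (Finset (Fin n))),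
      S ∉ (univ : Finset (Fin R)).biUnion bad := by
    by_contra hcon
    push Not at hcon
    exact absurd (card_le_card hcon) (not_le.2 hlt)
  refine ⟨S, (mem_powersetCard.1 hS).2, fun i => ?_⟩
  by_contra hge
  push Not at hge
  exact hSbad (mem_biUnion.2 ⟨i, mem_univ _, mem_filter.2 ⟨hS, hge⟩⟩)

/-! ### Averaged restrictions along an embedding -/

section Restrict

variable {n m : ℕ}

/-- The coordinates of `[n]` outside the image of `e : [m] ↪ [n]`. [folklore] -/
abbrev Outside (e : Fin m ↪ Fin n) : Type := {j : Fin n // j ∉ Set.range e}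

open Classical in
/-- **Splitting the cube along an embedding**: `{0,1}^n ≃ {0,1}^m × {0,1}^{[n] ∖ e[m]}`,
`x ↦ (x ∘ e, x|_{outside})`. [cite: ChanEtAl2016, §3.3 (arXiv v3 p. 10: "averaging over all variables outside S")] -/
def cubeSplit (e : Fin m ↪ Fin n) : (Fin n → Bool) ≃ (Fin m → Bool) × (Outside e → Bool) where
  toFun x := (x ∘ e, fun j => x j.1)
  invFun p j := if h : j ∈ Set.range e then p.1 (e.invOfMemRange ⟨j, h⟩) else p.2 ⟨j, h⟩
  left_inv x := by
    funext j
    dsimp only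
    split_ifs with h
    · exact congrArg x (e.left_inv_of_invOfMemRange ⟨j, h⟩)
    · rfl
  right_inv p := by
    ext i
    · dsimp only [Function.comp_apply]
      have h : e i ∈ Set.range ⇑e := ⟨i, rfl⟩
      rw [dif_pos h]
      exact congrArg p.1 (e.right_inv_of_invOfMemRange i)
    · dsimp only
      rw [dif_neg i.2]

/-- The first component of the split is the restriction `x ∘ e`. [folklore] -/
@[simp] private theorem cubeSplit_fst (e : Fin m ↪ Fin n) (x : Fin n → Bool) :
    (cubeSplit e x).1 = x ∘ e := rfl

/-- Points of the fibre of `y` restrict to `y`: `(cubeSplit e)⁻¹(y,z) ∘ e = y`. [folklore] -/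
@[simp] private theorem cubeSplit_symm_comp (e : Fin m ↪ Fin n) (y : Fin m → Bool) (z : Outside e → Bool) :
    (cubeSplit e).symm (y, z) ∘ e = y := by
  exact congrArg Prod.fst ((cubeSplit e).apply_symm_apply (y, z))

/-- There are `2^{n−m}` coordinates-outside assignments: `|Outside e| = n − m`. [folklore] -/
private theorem card_outside (e : Fin m ↪ Fin n) : Fintype.card (Outside e) = n - m := by
  classical
  rw [Fintype.card_subtype_compl, Fintype.card_fin, Set.card_range_of_injective e.injective,
    Fintype.card_fin]

/-- `m ≤ n` when `[m] ↪ [n]`. [folklore] -/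
private theorem le_of_embedding (e : Fin m ↪ Fin n) : m ≤ n := by
  simpa using Fintype.card_le_of_embedding e

/-- Summing over the cube fibre by fibre. [folklore] -/
private theorem sum_eq_sum_cubeSplit (e : Fin m ↪ Fin n) (F : (Fin n → Bool) → ℝ) :
    ∑ x, F x = ∑ y : Fin m → Bool, ∑ z : Outside e → Bool, F ((cubeSplit e).symm (y, z)) := by
  rw [← Fintype.sum_prod_type', ← (cubeSplit e).symm.sum_comp]

/-- **The averaged restriction** `q^S` of `q : {0,1}^n → ℝ` to the coordinates `S = e([m])`:
`q^S(y) = 2^{−(n−m)} Σ_{x : x∘e = y} q(x)` ("the conditional density on the variables in `S`").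
[cite: ChanEtAl2016, §3.3 (arXiv v3 p. 10: "q^S_i … the conditional density on the variables in S (equivalently, we obtain q^S_i by averaging over all variables outside S)")] -/
def avgRestrict (e : Fin m ↪ Fin n) (q : (Fin n → Bool) → ℝ) : (Fin m → Bool) → ℝ :=
  fun y => (∑ z : Outside e → Bool, q ((cubeSplit e).symm (y, z))) / 2 ^ (n - m)

/-- `q ≥ 0 ⟹ q^S ≥ 0`. [cite: ChanEtAl2016, §3.3 (arXiv v3 p. 10)] -/
theorem avgRestrict_nonneg (e : Fin m ↪ Fin n) {q : (Fin n → Bool) → ℝ} (hq : ∀ x, 0 ≤ q x)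
    (y : Fin m → Bool) : 0 ≤ avgRestrict e q y :=
  div_nonneg (sum_nonneg fun z _ => hq _) (by positivity)

/-- `q ≤ K ⟹ q^S ≤ K` (an average of values `≤ K`). [cite: ChanEtAl2016, §3.3 (arXiv v3 p. 10)] -/
theorem avgRestrict_le (e : Fin m ↪ Fin n) {q : (Fin n → Bool) → ℝ} {K : ℝ} (hq : ∀ x, q x ≤ K)
    (y : Fin m → Bool) : avgRestrict e q y ≤ K := by
  unfold avgRestrict
  rw [div_le_iff₀ (by positivity)]
  calc ∑ z : Outside e → Bool, q ((cubeSplit e).symm (y, z)) ≤ ∑ _z : Outside e → Bool, K :=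
        sum_le_sum fun z _ => hq _
    _ = K * 2 ^ (n - m) := by
        rw [sum_const, card_univ, Fintype.card_fun, Fintype.card_bool, card_outside, nsmul_eq_mul]
        push_cast; ring

/-- **Total mass is preserved**: `Σ_y q^S(y) = 2^{−(n−m)} Σ_x q(x)`; in particular a density
restricts to a density. [cite: ChanEtAl2016, §3.3 (arXiv v3 p. 10: "conditional density")] -/
theorem sum_avgRestrict (e : Fin m ↪ Fin n) (q : (Fin n → Bool) → ℝ) :
    ∑ y, avgRestrict e q y = (∑ x, q x) / 2 ^ (n - m) := by
  unfold avgRestrict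
  rw [← sum_div, sum_eq_sum_cubeSplit e q]

/-- A density restricts to a density: `Σ_x q = 2^n ⟹ Σ_y q^S = 2^m`. [cite: ChanEtAl2016, §3.3 (arXiv v3 p. 10)] -/
theorem sum_avgRestrict_of_density (e : Fin m ↪ Fin n) {q : (Fin n → Bool) → ℝ}
    (hq : ∑ x, q x = (2 : ℝ) ^ n) : ∑ y, avgRestrict e q y = (2 : ℝ) ^ m := by
  rw [sum_avgRestrict, hq, div_eq_iff (by positivity), ← pow_add, Nat.add_sub_cancel' (le_of_embedding e)]

/-- A character of `e(α)` is the character of `α` read through `e`: `χ_{e(α)}(x) = χ_α(x ∘ e)`. [folklore] -/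
private theorem walsh_map (e : Fin m ↪ Fin n) (α : Finset (Fin m)) (x : Fin n → Bool) :
    walsh (α.map e) x = walsh α (x ∘ e) := by
  unfold walsh
  rw [prod_map]
  rfl

/-- **Fourier coefficients of the averaged restriction**: `(q^S)^(α) = q̂(e(α))` for `α ⊆ [m]`
(p. 10: "`q^S_i = Σ_{α ⊆ S} q̂_i(α) χ_α`"). [cite: ChanEtAl2016, §3.3 (arXiv v3 p. 10)] -/
theorem cubeFourierCoeff_avgRestrict (e : Fin m ↪ Fin n) (q : (Fin n → Bool) → ℝ)
    (α : Finset (Fin m)) :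
    cubeFourierCoeff (avgRestrict e q) α = cubeFourierCoeff q (α.map e) := by
  have hmn := le_of_embedding e
  have h2 : (2 : ℝ) ^ n = 2 ^ (n - m) * 2 ^ m := by
    rw [← pow_add, Nat.sub_add_cancel hmn]
  have key : ∑ x, q x * walsh (α.map e) x = 2 ^ (n - m) * ∑ y, avgRestrict e q y * walsh α y := by
    simp_rw [walsh_map]
    rw [sum_eq_sum_cubeSplit e, mul_sum]
    refine sum_congr rfl fun y _ => ?_
    simp_rw [cubeSplit_symm_comp]
    rw [← sum_mul]
    unfold avgRestrict
    field_simp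
  unfold Literature.Computability.Complexity.LowDegree.cubeFourierCoeff
  rw [key, h2]
  field_simp

/-- **Averaging a pointwise identity over the fibres**: if `F(x ∘ e) = Σ_{l∈s} a_l V_l(x)` for all
`x ∈ {0,1}^n`, then `F = Σ_l a_l · (V_l)^S` on `{0,1}^m` — the restriction of the factorisation
(3.2) of `𝓛(ℑ_S) − ℑ_S` to the planted coordinates. [cite: ChanEtAl2016, §3.3 (arXiv v3 p. 10, eq. (3.2) and "q^S_i")] -/
theorem eq_sum_avgRestrict_of_forall (e : Fin m ↪ Fin n) {ι : Type*} (s : Finset ι) (a : ι → ℝ)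
    (V : ι → (Fin n → Bool) → ℝ) (F : (Fin m → Bool) → ℝ)
    (h : ∀ x : Fin n → Bool, F (x ∘ e) = ∑ l ∈ s, a l * V l x) (y : Fin m → Bool) :
    F y = ∑ l ∈ s, a l * avgRestrict e (V l) y := by
  have hz : ∀ z : Outside e → Bool, F y = ∑ l ∈ s, a l * V l ((cubeSplit e).symm (y, z)) := by
    intro z
    have := h ((cubeSplit e).symm (y, z))
    rwa [cubeSplit_symm_comp] at this
  have hcard : (Fintype.card (Outside e → Bool) : ℝ) = 2 ^ (n - m) := by
    rw [Fintype.card_fun, Fintype.card_bool, card_outside]; push_cast; ring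
  have key : (2 : ℝ) ^ (n - m) * F y =
      ∑ l ∈ s, a l * ∑ z : Outside e → Bool, V l ((cubeSplit e).symm (y, z)) := by
    rw [← hcard]
    calc (Fintype.card (Outside e → Bool) : ℝ) * F y = ∑ _z : Outside e → Bool, F y := by
          rw [sum_const, card_univ, nsmul_eq_mul]
      _ = ∑ z : Outside e → Bool, ∑ l ∈ s, a l * V l ((cubeSplit e).symm (y, z)) :=
          sum_congr rfl fun z _ => hz z
      _ = ∑ l ∈ s, ∑ z : Outside e → Bool, a l * V l ((cubeSplit e).symm (y, z)) := sum_comm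
      _ = ∑ l ∈ s, a l * ∑ z : Outside e → Bool, V l ((cubeSplit e).symm (y, z)) :=
          sum_congr rfl fun l _ => by rw [mul_sum]
  unfold avgRestrict
  have h2 : (2 : ℝ) ^ (n - m) ≠ 0 := by positivity
  calc F y = (2 ^ (n - m) * F y) / 2 ^ (n - m) := by field_simp
    _ = (∑ l ∈ s, a l * ∑ z : Outside e → Bool, V l ((cubeSplit e).symm (y, z))) / 2 ^ (n - m) := by
        rw [key]
    _ = ∑ l ∈ s, a l * ((∑ z : Outside e → Bool, V l ((cubeSplit e).symm (y, z))) / 2 ^ (n - m)) := by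
        rw [sum_div]; exact sum_congr rfl fun l _ => by ring

/-- Restricting a function of the planted coordinates gives it back: `(G ∘ (· ∘ e))^S = G`.
[cite: ChanEtAl2016, §3.3 (arXiv v3 p. 10: "Ẽ_S only depends on variables in S")] -/
theorem avgRestrict_comp (e : Fin m ↪ Fin n) (G : (Fin m → Bool) → ℝ) (y : Fin m → Bool) :
    avgRestrict e (fun x => G (x ∘ e)) y = G y := by
  unfold avgRestrict
  simp_rw [cubeSplit_symm_comp]
  rw [sum_const, card_univ, Fintype.card_fun, Fintype.card_bool, card_outside, nsmul_eq_mul]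
  push_cast
  field_simp

end Restrict

/-! ### Junta averaging on one cube -/

section Junta

variable {m : ℕ}

/-- **Averaging over the coordinates outside `J`**: `(A_J f)(x) = E_z f(x|_J, z|_{J^c})`
(`= Σ_{α ⊆ J} f̂(α) χ_α`, `avgOutside_eq_sum`).  [cite: ChanEtAl2016, §3.3 (arXiv v3 p. 10: "q̃^S_i = Σ_{α ⊆ J(q_i) ∩ S} q̂_i(α) χ_α is a non-negative d-junta")] -/
def avgOutside (J : Finset (Fin m)) (f : (Fin m → Bool) → ℝ) : (Fin m → Bool) → ℝ :=
  fun x => (∑ z, f (J.piecewise x z)) / 2 ^ m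

/-- `f ≥ 0 ⟹ A_J f ≥ 0`. [cite: ChanEtAl2016, §3.3 (arXiv v3 p. 10: "non-negative d-junta")] -/
theorem avgOutside_nonneg (J : Finset (Fin m)) {f : (Fin m → Bool) → ℝ} (hf : ∀ x, 0 ≤ f x)
    (x : Fin m → Bool) : 0 ≤ avgOutside J f x :=
  div_nonneg (sum_nonneg fun z _ => hf _) (by positivity)

/-- `A_J f` is a `|J|`-junta. [cite: ChanEtAl2016, §3.3 (arXiv v3 p. 10: "non-negative d-junta")] -/
theorem isJunta_avgOutside (J : Finset (Fin m)) (f : (Fin m → Bool) → ℝ) :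
    IsJunta J.card (avgOutside J f) := by
  refine ⟨J, le_rfl, fun x y hxy => ?_⟩
  unfold avgOutside
  congr 1
  refine sum_congr rfl fun z _ => ?_
  congr 1
  funext i
  by_cases hi : i ∈ J
  · rw [Finset.piecewise_eq_of_mem _ _ _ hi, Finset.piecewise_eq_of_mem _ _ _ hi, hxy i hi]
  · rw [Finset.piecewise_eq_of_notMem _ _ _ hi, Finset.piecewise_eq_of_notMem _ _ _ hi]

/-- **Fourier expansion of the junta average**: `A_J f = Σ_{α ⊆ J} f̂(α) χ_α` (O'Donnell Prop. 3.21
at `T = ∅`). [cite: ChanEtAl2016, §3.3 (arXiv v3 p. 10: "q̃^S_i = Σ_{α ⊆ J(q_i) ∩ S} q̂_i(α) χ_α")] -/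
theorem avgOutside_eq_sum (J : Finset (Fin m)) (f : (Fin m → Bool) → ℝ) (x : Fin m → Bool) :
    avgOutside J f x = ∑ S ∈ J.powerset, cubeFourierCoeff f S * walsh S x := by
  classical
  have h0 : avgOutside J f x = cubeFourierCoeff (fun z => f (J.piecewise x z)) ∅ := by
    unfold avgOutside Literature.Computability.Complexity.LowDegree.cubeFourierCoeff
    simp
  rw [h0, cubeFourierCoeff_piecewise]
  have hpow : J.powerset = univ.filter fun S : Finset (Fin m) => S ⊆ J := by
    ext S; simp
  rw [hpow, sum_filter]
  refine sum_congr rfl fun S _ => ?_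
  by_cases hS : S ⊆ J
  · have h1 : S.filter (fun i => i ∉ J) = ∅ := by
      rw [filter_eq_empty_iff]; exact fun i hi h => h (hS hi)
    have h2 : S.filter (fun i => i ∈ J) = S := by
      rw [filter_eq_self]; exact fun i hi => hS hi
    rw [if_pos h1, if_pos hS, h2]
    rfl
  · have h1 : S.filter (fun i => i ∉ J) ≠ ∅ := by
      obtain ⟨i, hi, hiJ⟩ := not_subset.1 hS
      exact Nonempty.ne_empty ⟨i, mem_filter.2 ⟨hi, hiJ⟩⟩
    rw [if_neg h1, if_neg hS]

/-- **Coefficients of the junta average**: `(A_J f)^(α) = f̂(α)` if `α ⊆ J`, else `0`.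
[cite: ChanEtAl2016, §3.3 (arXiv v3 p. 10)] -/
theorem cubeFourierCoeff_avgOutside (J : Finset (Fin m)) (f : (Fin m → Bool) → ℝ)
    (α : Finset (Fin m)) :
    cubeFourierCoeff (avgOutside J f) α = if α ⊆ J then cubeFourierCoeff f α else 0 := by
  have h : avgOutside J f = fun x => ∑ S ∈ J.powerset, cubeFourierCoeff f S * walsh S x :=
    funext (avgOutside_eq_sum J f)
  rw [h, cubeFourierCoeff_sum_walsh]
  simp only [mem_powerset]

end Junta

/-! ### Lemma 2.4: the Sherali–Adams functional on characters, and its truncation -/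

section Functional

variable {m d : ℕ}

/-- Additivity of `ĝ(S)` in `g`. [folklore] -/
private theorem cubeFourierCoeff_add' (f g : (Fin m → Bool) → ℝ) (S : Finset (Fin m)) :
    cubeFourierCoeff (f + g) S = cubeFourierCoeff f S + cubeFourierCoeff g S := by
  unfold Literature.Computability.Complexity.LowDegree.cubeFourierCoeff
  rw [← add_div, ← sum_add_distrib]
  congr 1
  exact sum_congr rfl fun x _ => by simp [add_mul]

/-- Homogeneity of `ĝ(S)` in `g`. [folklore] -/
private theorem cubeFourierCoeff_smul' (c : ℝ) (f : (Fin m → Bool) → ℝ) (S : Finset (Fin m)) :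
    cubeFourierCoeff (c • f) S = c * cubeFourierCoeff f S := by
  unfold Literature.Computability.Complexity.LowDegree.cubeFourierCoeff
  rw [mul_div_assoc', mul_sum]
  congr 1
  exact sum_congr rfl fun x _ => by simp [mul_assoc]

/-- Coefficients of a density are bounded by one: `f ≥ 0`, `Σ f = 2^m` ⟹ `|f̂(S)| ≤ 1`
("first using `E q_i = 1`"). [cite: ChanEtAl2016, §3.3 (arXiv v3 p. 10)] -/
theorem abs_cubeFourierCoeff_le_one_of_density {f : (Fin m → Bool) → ℝ} (hf0 : ∀ x, 0 ≤ f x)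
    (hf1 : ∑ x, f x = (2 : ℝ) ^ m) (S : Finset (Fin m)) : |cubeFourierCoeff f S| ≤ 1 := by
  unfold Literature.Computability.Complexity.LowDegree.cubeFourierCoeff
  rw [abs_div, abs_of_pos (by positivity : (0 : ℝ) < 2 ^ m), div_le_one (by positivity), ← hf1]
  refine (abs_sum_le_sum_abs _ _).trans (sum_le_sum fun x _ => ?_)
  rw [abs_mul, abs_walsh, mul_one, abs_of_nonneg (hf0 x)]

/-- **The Fourier truncation `f ↦ f_{≤ d} = Σ_{|S| ≤ d} f̂(S) χ_S` as a linear map.**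
[cite: ChanEtAl2016, §2.1 (arXiv v3 p. 8: "we can extend it linearly to all of L² … by setting Ẽ f = 0 for all functions f orthogonal to the space of degree-d multilinear polynomials")] -/
def truncLM (m d : ℕ) : ((Fin m → Bool) → ℝ) →ₗ[ℝ] ((Fin m → Bool) → ℝ) where
  toFun := fourierTruncate d
  map_add' f g := by
    funext x
    simp only [fourierTruncate, Pi.add_apply, cubeFourierCoeff_add', add_mul, sum_add_distrib]
  map_smul' c f := by
    funext x
    simp only [fourierTruncate, Pi.smul_apply, smul_eq_mul, RingHom.id_apply, cubeFourierCoeff_smul',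
      mul_assoc, mul_sum]

/-- Unfolding `truncLM`. [cite: ChanEtAl2016, §2.1 (arXiv v3 p. 8)] -/
@[simp] theorem truncLM_apply (f : (Fin m → Bool) → ℝ) : truncLM m d f = fourierTruncate d f := rfl

/-- A function of degree `≤ d` is its own truncation (Fourier inversion).
[cite: ChanEtAl2016, §2.1 (arXiv v3 p. 8)] -/
theorem fourierTruncate_eq_self_of_hasDegreeLE {f : (Fin m → Bool) → ℝ} (hf : HasDegreeLE d f) :
    fourierTruncate d f = f := by
  funext x
  unfold fourierTruncate
  rw [← sum_cubeFourierCoeff_mul_walsh f x]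
  refine (sum_subset (filter_subset _ _) fun S _ hS => ?_)
  rw [mem_filter, not_and] at hS
  rw [hf.cubeFourierCoeff_eq_zero (not_le.1 (hS (mem_univ S))), zero_mul]

/-- The truncation as a combination of characters, as an identity of functions. [cite: ChanEtAl2016, §2.1 (arXiv v3 p. 8)] -/
private theorem fourierTruncate_eq_sum_smul (f : (Fin m → Bool) → ℝ) :
    fourierTruncate d f = ∑ S ∈ univ.filter (fun S : Finset (Fin m) => S.card ≤ d),
      cubeFourierCoeff f S • (walsh S : (Fin m → Bool) → ℝ) := by
  funext x
  unfold fourierTruncate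
  rw [Finset.sum_apply]
  simp only [Pi.smul_apply, smul_eq_mul]

namespace SAPseudoexpectation

/-- **Lemma 2.4 (ii): `|Ẽ χ_α| ≤ 1` for `|α| ≤ d`** (`1 ± χ_α` are nonnegative `d`-juntas).
[cite: ChanEtAl2016, Lemma 2.4 (ii) (arXiv v3 p. 8)] -/
theorem abs_E_walsh_le_one (pE : SAPseudoexpectation m d) {α : Finset (Fin m)} (hα : α.card ≤ d) :
    |pE.E (walsh α)| ≤ 1 := by
  have hj : ∀ s : ℝ, IsJunta d (fun x => 1 + s * walsh α x) := fun s =>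
    ⟨α, hα, fun x y hxy => by
      simp only
      rw [show walsh α x = walsh α y from prod_congr rfl fun i hi => by rw [hxy i hi]]⟩
  have hnn : ∀ s : ℝ, |s| ≤ 1 → ∀ x, 0 ≤ 1 + s * walsh α x := by
    intro s hs x
    have h1 : |s * walsh α x| ≤ 1 := by rw [abs_mul, abs_walsh, mul_one]; exact hs
    linarith [neg_abs_le (s * walsh α x)]
  have hlin : ∀ s : ℝ, pE.E (fun x => 1 + s * walsh α x) = 1 + s * pE.E (walsh α) := by
    intro s
    have : (fun x => 1 + s * walsh α x) =
        (fun _ => (1 : ℝ)) + s • (walsh α : (Fin m → Bool) → ℝ) := by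
      funext x; simp
    rw [this, map_add, map_smul, pE.map_one, smul_eq_mul]
  have h1 := pE.nonneg _ (hj 1) (hnn 1 (by norm_num))
  have h2 := pE.nonneg _ (hj (-1)) (hnn (-1) (by norm_num))
  rw [hlin] at h1 h2
  rw [abs_le]; constructor <;> linarith

/-- **The truncated functional `Ẽ ∘ (·)_{≤ d}`** — the tree's rendering of the extension of a
`d`-ℓ.e.f. by zero on the characters of degree `> d`; it is again a degree-`d` Sherali–Adams
pseudoexpectation (nonnegative `d`-juntas and constants have degree `≤ d`, so are untouched).
[cite: ChanEtAl2016, §2.1 (arXiv v3 p. 8: "We will assume that every d-ℓef has been extended thusly")] -/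
def truncate (pE : SAPseudoexpectation m d) : SAPseudoexpectation m d where
  E := pE.E ∘ₗ truncLM m d
  nonneg p hp hp0 := by
    rw [LinearMap.comp_apply, truncLM_apply, fourierTruncate_eq_self_of_hasDegreeLE hp.hasDegreeLE]
    exact pE.nonneg p hp hp0
  map_one := by
    rw [LinearMap.comp_apply, truncLM_apply,
      fourierTruncate_eq_self_of_hasDegreeLE (isJunta_const d (1 : ℝ)).hasDegreeLE]
    exact pE.map_one

/-- Unfolding the truncated functional. [cite: ChanEtAl2016, §2.1 (arXiv v3 p. 8)] -/
theorem truncate_E (pE : SAPseudoexpectation m d) (f : (Fin m → Bool) → ℝ) :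
    pE.truncate.E f = pE.E (fourierTruncate d f) := rfl

/-- The truncated functional agrees with `Ẽ` on functions of degree `≤ d` (in particular on the
objective `ℑ` when `k ≤ d`). [cite: ChanEtAl2016, §2.1 (arXiv v3 p. 8)] -/
theorem truncate_E_of_hasDegreeLE (pE : SAPseudoexpectation m d) {f : (Fin m → Bool) → ℝ}
    (hf : HasDegreeLE d f) : pE.truncate.E f = pE.E f := by
  rw [truncate_E, fourierTruncate_eq_self_of_hasDegreeLE hf]

/-- `Ẽ_trunc f = Σ_{|S| ≤ d} f̂(S) Ẽ χ_S` (the Fourier representation of a `d`-ℓ.e.f.).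
[cite: ChanEtAl2016, §2.1 (arXiv v3 p. 8: "Ẽ = Σ_{|α| ≤ d} Ẽ(χ_α) χ_α")] -/
theorem truncate_E_eq_sum (pE : SAPseudoexpectation m d) (f : (Fin m → Bool) → ℝ) :
    pE.truncate.E f = ∑ S ∈ univ.filter (fun S : Finset (Fin m) => S.card ≤ d),
      cubeFourierCoeff f S * pE.E (walsh S) := by
  rw [truncate_E, fourierTruncate_eq_sum_smul, map_sum]
  exact sum_congr rfl fun S _ => by rw [map_smul, smul_eq_mul]

/-- **Lemma 2.4 (iii), the form used on p. 10**: `|Ẽ_trunc f| ≤ Σ_{|S| ≤ d} |f̂(S)|`.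
[cite: ChanEtAl2016, Lemma 2.4 (iii) (arXiv v3 p. 8) and eq. (3.3) (p. 10)] -/
theorem abs_truncate_E_le (pE : SAPseudoexpectation m d) (f : (Fin m → Bool) → ℝ) :
    |pE.truncate.E f| ≤ ∑ S ∈ univ.filter (fun S : Finset (Fin m) => S.card ≤ d),
      |cubeFourierCoeff f S| := by
  rw [truncate_E_eq_sum]
  refine (abs_sum_le_sum_abs _ _).trans (sum_le_sum fun S hS => ?_)
  rw [abs_mul]
  have h := pE.abs_E_walsh_le_one (mem_filter.1 hS).2
  calc |cubeFourierCoeff f S| * |pE.E (walsh S)| ≤ |cubeFourierCoeff f S| * 1 := by gcongr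
    _ = |cubeFourierCoeff f S| := mul_one _

/-- For a density `f` (`f ≥ 0`, `Σ f = 2^m`): `|Ẽ_trunc f| ≤ #{S : |S| ≤ d}` ("`|Ẽ_S(q_i)| ≤
‖Ẽ_S‖_∞ ≤ \binom{m}{≤ d}`, first using `E q_i = 1` and then property (iii)").
[cite: ChanEtAl2016, §3.3 (arXiv v3 p. 10)] -/
theorem abs_truncate_E_le_card (pE : SAPseudoexpectation m d) {f : (Fin m → Bool) → ℝ}
    (hf0 : ∀ x, 0 ≤ f x) (hf1 : ∑ x, f x = (2 : ℝ) ^ m) :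
    |pE.truncate.E f| ≤ (univ.filter (fun S : Finset (Fin m) => S.card ≤ d)).card := by
  refine (pE.abs_truncate_E_le f).trans ?_
  calc ∑ S ∈ univ.filter (fun S : Finset (Fin m) => S.card ≤ d), |cubeFourierCoeff f S|
      ≤ ∑ _S ∈ univ.filter (fun S : Finset (Fin m) => S.card ≤ d), (1 : ℝ) :=
        sum_le_sum fun S _ => abs_cubeFourierCoeff_le_one_of_density hf0 hf1 S
    _ = _ := by rw [sum_const, nsmul_eq_mul, mul_one]

/-- **The error term (3.3)**: if `f̂` vanishes on the sets `α ⊆ J` and is `≤ γ` in absolute value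
on every other `α` with `|α| ≤ d`, then `|Ẽ_trunc f| ≤ γ · #{S : |S| ≤ d}`.
[cite: ChanEtAl2016, §3.3 eq. (3.3) (arXiv v3 p. 10: "|Ẽ_S(e_i)| ≤ Σ_{α ⊆ S} |Ẽ_S[χ_α]| · |ê_i(α)| ≤ \binom{m}{≤d} (16mtd/√n)^{1/2}")] -/
theorem abs_truncate_E_le_mul_card (pE : SAPseudoexpectation m d) {f : (Fin m → Bool) → ℝ}
    {γ : ℝ} (hγ : ∀ S : Finset (Fin m), S.card ≤ d → |cubeFourierCoeff f S| ≤ γ) :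
    |pE.truncate.E f| ≤ γ * (univ.filter (fun S : Finset (Fin m) => S.card ≤ d)).card := by
  refine (pE.abs_truncate_E_le f).trans ?_
  calc ∑ S ∈ univ.filter (fun S : Finset (Fin m) => S.card ≤ d), |cubeFourierCoeff f S|
      ≤ ∑ _S ∈ univ.filter (fun S : Finset (Fin m) => S.card ≤ d), γ :=
        sum_le_sum fun S hS => hγ S (mem_filter.1 hS).2
    _ = _ := by rw [sum_const, nsmul_eq_mul, mul_comm]

end SAPseudoexpectation

end Functional

end Literature.Combinatorics.Optimization

end
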